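import Literature.RingTheory.MvPolynomial.KaltofenNoetherFormsThm7Proofs
import Mathlib.RingTheory.MvPolynomial.IrreducibleQuadratic
import HarnessLib

/-!
# Absolute irreducibility survives almost every specialisation of the coefficients

Topic `Literature/AlgebraicGeometry/Motives`; a step (Noether–Ostrowski specialisation) of the
elementary proof of the two-point curve lemma (`Motives/CurveThroughTwoPoints`,
`mumford_smoothCurve_through_two_points`; Mumford, *Abelian Varieties*, §6). Let `R` be a domain
with fraction field `K` and `F ∈ R[X₁, …, X_N]` a polynomial whose image in `K[X]` is absolutely
irreducible of total degree `d ≥ 1`. Then there is `δ ∈ R ∖ {0}` such that for EVERY ring map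
`π : R → k` to a field with `π δ ≠ 0`, the specialised polynomial `F^π ∈ k[X]` is again absolutely
irreducible of total degree `d` (`exists_ne_zero_forall_isAbsIrreducible_map`). For `d ≥ 2` (and
`N ≥ 2`) this is E. Noether's theorem in Kaltofen's form: some Noether irreducibility form `Φ_t`
(an integer polynomial in the coefficients, PROVED to exist in the tree:
`Literature.RingTheory.MvPolynomial.kaltofen1995_thm7_holds`, Kaltofen 1995, Thm. 7) does not
vanish at the coefficients of `F`, and `δ := Φ_t(coeff F) ∈ R` commutes with `π`; for `d = 1` take
for `δ` a coefficient of a degree-one monomial (`isAbsIrreducible_of_totalDegree_eq_one`). In the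
proof of Mumford's lemma this is applied to the hypersurface model of the pencil over the relative
algebraic closure `R'`, `π` being the reduction modulo a maximal ideal of `R'`.

Everything is proved; no named facts.

## References

* E. Kaltofen, J. Comput. System Sci. 50 (1995) 274–295, Thm. 7. [Kaltofen1995]
* W. Schmidt, *Equations over Finite Fields*, LNM 536 (1976), Ch. V Thm. 2A (Noether's theorem).
  [Schmidt1976]
* D. Mumford, *Abelian Varieties* (1970), §6, Lemma. [MumfordAV1970]
-/

noncomputable section

open MvPolynomial

namespace Literature.AlgebraicGeometry.Motives

namespace TwoPointPencil

open Literature.NumberTheory.DiophantineGeometry (IsAbsIrreducible)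
open Literature.RingTheory.MvPolynomial (kaltofen1995_thm7_holds)

universe u

variable {σ : Type*}

/-- The total degree does not change under an injective change of coefficients (the support is
preserved). [folklore] -/
theorem totalDegree_map_of_injective {R S : Type*} [CommSemiring R] [CommSemiring S]
    (p : MvPolynomial σ R) {f : R →+* S} (hf : Function.Injective f) :
    (MvPolynomial.map f p).totalDegree = p.totalDegree := by
  simp only [totalDegree, support_map_of_injective p hf]

/-- The total degree can only drop under a change of coefficients. [folklore] -/
theorem totalDegree_map_le' {R S : Type*} [CommSemiring R] [CommSemiring S] (f : R →+* S)
    (p : MvPolynomial σ R) : (MvPolynomial.map f p).totalDegree ≤ p.totalDegree :=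
  Finset.sup_mono (support_map_subset f p)

/-- Evaluating an integer polynomial at the images of elements under a ring map is the image of
the evaluation. [folklore] -/
theorem aeval_comp_intPoly {R S : Type*} [CommRing R] [CommRing S] (π : R →+* S) {τ : Type*}
    (a : τ → R) (Φ : MvPolynomial τ ℤ) :
    MvPolynomial.aeval (fun e => π (a e)) Φ = π (MvPolynomial.aeval a Φ) := by
  rw [MvPolynomial.aeval_def, MvPolynomial.aeval_def, MvPolynomial.eval₂_comp_left π]
  congr 1
  exact RingHom.ext_int _ _

/-- **A polynomial of total degree one over a field is absolutely irreducible.** [folklore] -/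
theorem isAbsIrreducible_of_totalDegree_eq_one {k : Type*} [Field k] {N : ℕ}
    {f : MvPolynomial (Fin N) k} (hf : f.totalDegree = 1) : IsAbsIrreducible f := by
  unfold IsAbsIrreducible
  apply MvPolynomial.irreducible_of_totalDegree_eq_one
  · rw [totalDegree_map_of_injective f (algebraMap k (AlgebraicClosure k)).injective, hf]
  · intro x hx
    rcases eq_or_ne x 0 with rfl | hx0
    · exfalso
      have : MvPolynomial.map (algebraMap k (AlgebraicClosure k)) f = 0 := by
        ext i
        simpa using hx i
      have h0 : (MvPolynomial.map (algebraMap k (AlgebraicClosure k)) f).totalDegree = 0 := by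
        rw [this, totalDegree_zero]
      rw [totalDegree_map_of_injective f (algebraMap k (AlgebraicClosure k)).injective, hf] at h0
      exact one_ne_zero h0
    · exact isUnit_iff_ne_zero.mpr hx0

/-- **Noether–Ostrowski specialisation.** Let `R` be a domain with fraction field `K`, `N ≥ 2`,
and `F ∈ R[X₁, …, X_N]` with `F_K` absolutely irreducible of total degree `d ≥ 1`. There is
`δ ∈ R`, `δ ≠ 0`, such that for every ring map `π : R → k` to a field with `π δ ≠ 0`, `F^π` is
absolutely irreducible of total degree `d`. (For `d ≥ 2`: a Noether form `Φ_t` of Kaltofen's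
Theorem 7 with `Φ_t(coeff F) ≠ 0`, `δ := Φ_t(coeff F)`; the forms have integer coefficients, so
`Φ_t(coeff F^π) = π δ`. For `d = 1`: a nonzero coefficient.)
[cite: Kaltofen1995, Thm. 7] -/
theorem exists_ne_zero_forall_isAbsIrreducible_map {R : Type u} [CommRing R] [IsDomain R]
    {K : Type u} [Field K] [Algebra R K] [IsFractionRing R K] {N d : ℕ} (hN : 2 ≤ N) (hd : 1 ≤ d)
    (F : MvPolynomial (Fin N) R) (hdeg : (MvPolynomial.map (algebraMap R K) F).totalDegree = d)
    (hirr : IsAbsIrreducible (MvPolynomial.map (algebraMap R K) F)) :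
    ∃ δ : R, δ ≠ 0 ∧ ∀ (k : Type u) [Field k] (π : R →+* k), π δ ≠ 0 →
      (MvPolynomial.map π F).totalDegree = d ∧ IsAbsIrreducible (MvPolynomial.map π F) := by
  have hinj : Function.Injective (algebraMap R K) := IsFractionRing.injective R K
  have hdegR : F.totalDegree = d := by rw [← totalDegree_map_of_injective F hinj, hdeg]
  rcases Nat.lt_or_ge d 2 with hd1 | hd2
  · -- `d = 1`: a nonzero coefficient of a degree-one monomial
    have hd1 : d = 1 := by omega
    subst hd1
    -- some monomial of degree `1` occurs in `F`
    obtain ⟨m, hm, hmdeg⟩ : ∃ m ∈ F.support, (m.sum fun _ e => e) = 1 := by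
      classical
      have hne : F.support.Nonempty := by
        rw [Finset.nonempty_iff_ne_empty, Ne, MvPolynomial.support_eq_empty]
        rintro rfl
        simp at hdegR
      obtain ⟨m, hm, hmax⟩ := Finset.exists_max_image F.support (fun m => m.sum fun _ e => e) hne
      refine ⟨m, hm, le_antisymm ?_ ?_⟩
      · have : (m.sum fun _ e => e) ≤ F.totalDegree := Finset.le_sup (f := fun m => m.sum fun _ e => e) hm
        rwa [hdegR] at this
      · have h1 : F.totalDegree ≤ m.sum fun _ e => e := Finset.sup_le fun b hb => hmax b hb
        rwa [hdegR] at h1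
    refine ⟨F.coeff m, mem_support_iff.mp hm, fun k _ π hπ => ?_⟩
    have hdegπ : (MvPolynomial.map π F).totalDegree = 1 := by
      apply le_antisymm
      · exact (totalDegree_map_le' π F).trans hdegR.le
      · rw [← hmdeg]
        unfold MvPolynomial.totalDegree
        exact Finset.le_sup (f := fun m : Fin N →₀ ℕ => m.sum fun _ e => e)
          (by rw [mem_support_iff, coeff_map]; exact hπ)
    exact ⟨hdegπ, isAbsIrreducible_of_totalDegree_eq_one hdegπ⟩
  · -- `d ≥ 2`: Noether forms
    obtain ⟨ι, _, Φ, -, hΦ⟩ := kaltofen1995_thm7_holds N d hN hd2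
    have hK := hΦ K (MvPolynomial.map (algebraMap R K) F) hdeg.le
    have hnot : ¬ ∀ t, MvPolynomial.aeval
        (fun e : Fin N →₀ ℕ => (MvPolynomial.map (algebraMap R K) F).coeff e) (Φ t) = 0 := by
      intro h
      rcases hK.mp h with h1 | h2
      · exact absurd h1 (not_lt.mpr hdeg.ge)
      · exact h2 hirr
    obtain ⟨t, ht⟩ := not_forall.mp hnot
    set δ : R := MvPolynomial.aeval (fun e : Fin N →₀ ℕ => F.coeff e) (Φ t) with hδ
    have hδK : MvPolynomial.aeval
        (fun e : Fin N →₀ ℕ => (MvPolynomial.map (algebraMap R K) F).coeff e) (Φ t) =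
          algebraMap R K δ := by
      simp only [coeff_map]
      exact aeval_comp_intPoly (algebraMap R K) (fun e => F.coeff e) (Φ t)
    refine ⟨δ, fun h0 => ht (by rw [hδK, h0, map_zero]), fun k _ π hπ => ?_⟩
    have hle : (MvPolynomial.map π F).totalDegree ≤ d := (totalDegree_map_le' π F).trans hdegR.le
    have hk := hΦ k (MvPolynomial.map π F) hle
    have hπt : MvPolynomial.aeval (fun e : Fin N →₀ ℕ => (MvPolynomial.map π F).coeff e) (Φ t) =
        π δ := by
      simp only [coeff_map]
      exact aeval_comp_intPoly π (fun e => F.coeff e) (Φ t)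
    have hnot' : ¬ ∀ t, MvPolynomial.aeval
        (fun e : Fin N →₀ ℕ => (MvPolynomial.map π F).coeff e) (Φ t) = 0 := fun h =>
      hπ (hπt ▸ h t)
    obtain ⟨h1, h2⟩ := not_or.mp (mt hk.mpr hnot')
    exact ⟨le_antisymm hle (not_lt.mp h1), not_not.mp h2⟩

end TwoPointPencil

end Literature.AlgebraicGeometry.Motives

end
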